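import Mathlib
import HarnessLib

/-!
# Positive semidefinite matrices with a chordal sparsity pattern: the clique decomposition

The linear-algebra fact behind CHORDAL (clique) DECOMPOSITION / conversion of sparse semidefinite
programs (Vandenberghe–Andersen [VA15, §9.2 Thm 9.2]; originally Griewank–Toint [GT84, Thm 4],
Agler–Helton–McCullough–Rodman [AHMR88, Thm 2.3], with a direct proof by Kakimura [Ka10, Thm 1]):

> [VA15, Thm 9.2] Let `E` be a chordal sparsity pattern of order `n`. Then `A ∈ 𝐒ⁿ₊ ∩ 𝐒ⁿ_E`
> (positive semidefinite with sparsity pattern `E`) if and only if it can be expressed as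
> `A = Σ_{β ∈ 𝒞} P_βᵀ H_β P_β` where `𝒞` is the set of cliques of the sparsity graph and the
> matrices `H_β` are symmetric and positive semidefinite.

i.e. the cone of PSD matrices with a chordal pattern is the sum of the (much smaller) PSD cones of
its cliques, `𝐒ⁿ₊ ∩ 𝐒ⁿ_E = Σ_β 𝒦_β` [VA15, (9.6)] — which is what licenses replacing one large
LMI `A ⪰ 0` by clique-sized LMIs `H_β ⪰ 0` plus linear consistency constraints.

## Formalisation choices (namespace `Literature.LinearAlgebra.Matrix.ChordalSparsity`)

* CHORDALITY IS STATED THROUGH A PERFECT ELIMINATION ORDERING.  By [VA15, §4.2 Thm 4.1]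
  (Fulkerson–Gross) a graph is chordal iff it has a perfect elimination ordering, i.e. an ordering
  for which the ordered graph is FILLED / MONOTONE TRANSITIVE [VA15, §4.1 (4.1)–(4.2)]:
  `i < j, i < k, {i,j} ∈ E, {i,k} ∈ E ⟹ {j,k} ∈ E`.  Here the index type `ι` carries a
  `LinearOrder` (the elimination ordering) and the pattern is a symmetric relation
  `E : ι → ι → Prop` with `MonotoneTransitive E`; for a `SimpleGraph ι` take `E = G.Adj`
  (`simpleGraph_exists_clique_decomposition`).  The graph-theoretic equivalence with "no chordless
  cycle of length `> 3`" (Thm 4.1) is deliberately NOT formalised here.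
* `HasPattern E X` — `X ∈ 𝕜ⁿ_E`: `X i j = 0` whenever `i ≠ j` and `¬ E i j` [VA15, §8.1];
  `SupportedOn C X` — `X` vanishes outside the block `C × C` (`X = P_Cᵀ H P_C`);
  `clique E v` — the closed higher neighbourhood `col(v) = {v} ∪ adj⁺(v)` [VA15, §2.2 (p. 248)],
  which in a filled graph is complete (`clique_complete`, [VA15, (4.1)]) and every (maximal) clique
  is `col(v)` of its lowest vertex [VA15, §4.4 (p. 282)].
* THE THEOREM is proved and stated per vertex, exactly as the proof of [VA15, Thm 9.2] produces it
  from the zero-fill outer-product Cholesky factorisation [VA15, (9.5)]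
  `A = Σ_j D_jj P_{γ_j}ᵀ L_{γ_j j} L_{γ_j j}ᵀ P_{γ_j}`, `γ_j = col(j)`:
  `exists_clique_decomposition` — a PSD `X` with a monotone-transitive pattern is `Σ_v H_v` with
  every `H_v ⪰ 0` supported on `col(v) × col(v)`; `posSemidef_and_hasPattern_iff` is the `iff` of
  Thm 9.2 in this form, and `exists_decomposition_of_cover` regroups the terms over any family of
  index sets `β k ⊇ col(v)` (e.g. the maximal cliques, [VA15, (9.4)]).  Scalars are `𝕜 = ℝ` or `ℂ`
  (`RCLike`; [VA15] is stated for real symmetric matrices, [GJSW84] for Hermitian ones — the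
  elimination argument below is the same verbatim).
* THE PROOF is one symbolic elimination step iterated along the ordering
  (`Finset.induction_on_min`): for the lowest remaining vertex `a` with pivot `d = X a a ≠ 0` the
  clique term `pivotTerm X a = d⁻¹ X_{:,a} X_{a,:}` is PSD and supported on `col(a) × col(a)`
  (pattern + minimality of `a`), and the Schur complement `X - pivotTerm X a` is PSD
  (`posSemidef_sub_pivotTerm`: `x⋆(X - K)x = z⋆ X z` with `z = x - d⁻¹ (X_{a,:} x) e_a`), has zero
  row/column `a`, and keeps the pattern `E` — this is where monotone transitivity (zero fill-in)
  enters; a zero pivot forces a zero row/column ([HJ13, Obs. 7.1.10], via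
  `Matrix.PosSemidef.dotProduct_mulVec_zero_iff`).

(page check: author-hosted copy of [VA15] = held text `paper:url-1b9fdea6a8a3`, PDF p. 12 = book
p. 248 (§2.2, `col(v)`), p. 38 = p. 274 (§4.1, (4.1)–(4.2)), p. 40 = p. 276 (§4.2, Thm 4.1),
p. 46 = p. 282 (§4.4), pp. 104–106 = pp. 340–342 (§9.2, Thm 9.2, (9.4)–(9.6) and the attribution
"[106, theorem 4] [1, theorem 2.3] [122, theorem 1]"), pp. 119–121 = pp. 355–357 (§10.1,
Thm 10.1); secondary statement of the decomposition theorem: Zheng–Fantuzzi–Papachristodoulou,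
arXiv:2007.11410, Thm 4 (held text p. 16).)

Deliberately NOT here: the dual / completion theorem [VA15, §10.1 Thm 10.1] = Grone–Johnson–Sá–
Wolkowicz [GJSW84, Thm 7] (a partial matrix with chordal pattern has a PSD completion iff all its
clique submatrices are PSD), clique trees and the running-intersection property [VA15, Ch. 3–4],
the characterisation of chordality by chordless cycles [VA15, Thm 4.1], minimum-rank completions,
and anything algorithmic (supernodal elimination trees, the conversion method of [VA15, Ch. 12]).

## References

* [VA15] L. Vandenberghe, M. S. Andersen, *Chordal Graphs and Semidefinite Optimization*,
  Foundations and Trends in Optimization 1(4) (2015) 241–433, §2.2, §4.1–4.2, §4.4, §8.1, §9.2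
  (Thm 9.2, (9.4)–(9.6)), §10.1 (Thm 10.1) (bib: VandenbergheAndersen2015;
  doi:10.1561/2400000006; held author copy checked).
* [AHMR88] J. Agler, J. W. Helton, S. McCullough, L. Rodman, *Positive semidefinite matrices with a
  given sparsity pattern*, Linear Algebra Appl. 107 (1988) 101–149, Thm 2.3
  (bib: AglerHeltonMcCulloughRodman1988; cited through [VA15, §9.2]).
* [GT84] A. Griewank, Ph. L. Toint, *On the existence of convex decompositions of partially
  separable functions*, Math. Programming 28 (1984) 25–49, Thm 4 (bib: GriewankToint1984; cited
  through [VA15, §9.2]).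
* [Ka10] N. Kakimura, *A direct proof for the matrix decomposition of chordal-structured positive
  semidefinite matrices*, Linear Algebra Appl. 433 (2010) 819–823, Thm 1 (bib: Kakimura2010;
  cited through [VA15, §9.2]).
* [GJSW84] R. Grone, C. R. Johnson, E. M. Sá, H. Wolkowicz, *Positive definite completions of
  partial Hermitian matrices*, Linear Algebra Appl. 58 (1984) 109–124, Thm 7
  (bib: GroneJohnsonSaWolkowicz1984; cited through [VA15, §10.1]).
* [HJ13] R. A. Horn, C. R. Johnson, *Matrix Analysis*, 2nd ed., CUP (2013), §7.1 Observation
  7.1.10 (bib: HornJohnson2013).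
-/

noncomputable section

open scoped ComplexOrder
open Matrix Finset

namespace Literature.LinearAlgebra.Matrix

namespace ChordalSparsity

variable {𝕜 : Type*} [RCLike 𝕜]
variable {ι : Type*}

/-! ### Ordered sparsity graphs: monotone transitivity and the cliques `col(v)` -/

section Graph

/-- An ordered graph (vertex type `ι` with its linear order as the ordering, symmetric adjacency
relation `E`) is FILLED, or MONOTONE TRANSITIVE, if all higher neighbourhoods induce complete
subgraphs: `i < j`, `i < k`, `j ≠ k`, `{i,j} ∈ E`, `{i,k} ∈ E ⟹ {j,k} ∈ E`.  An ordering with this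
property is a PERFECT ELIMINATION ORDERING, and a graph has one iff it is chordal
([VA15, §4.2 Thm 4.1], Fulkerson–Gross). [cite: VandenbergheAndersen2015, §4.1 eq. (4.2)] -/
def MonotoneTransitive [LT ι] (E : ι → ι → Prop) : Prop :=
  ∀ ⦃i j k : ι⦄, i < j → i < k → j ≠ k → E i j → E i k → E j k

/-- The closed higher (monotone) neighbourhood `col(v) = {v} ∪ adj⁺(v) = {v} ∪ {w ≻ v | {v,w} ∈ E}`
of a vertex of an ordered graph — the column support of vertex `v` in the array picture; in a
filled graph these are complete and every clique is `col(v)` of its lowest vertex `v`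
([VA15, §4.4]). [cite: VandenbergheAndersen2015, §2.2 (p. 248)] -/
def clique [LT ι] (E : ι → ι → Prop) (v : ι) : Set ι :=
  {w | w = v ∨ (v < w ∧ E v w)}

/-- Membership in `col(v)`. [cite: VandenbergheAndersen2015, §2.2 (p. 248)] -/
theorem mem_clique_iff [LT ι] {E : ι → ι → Prop} {v w : ι} :
    w ∈ clique E v ↔ w = v ∨ (v < w ∧ E v w) :=
  Iff.rfl

/-- `v ∈ col(v)`. [cite: VandenbergheAndersen2015, §2.2 (p. 248)] -/
theorem mem_clique_self [LT ι] (E : ι → ι → Prop) (v : ι) : v ∈ clique E v :=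
  mem_clique_iff.mpr (Or.inl rfl)

/-- In a filled (monotone transitive) ordered graph every `col(v)` is complete: any two distinct
members are adjacent. [cite: VandenbergheAndersen2015, §4.1 eq. (4.1)] -/
theorem clique_complete [LT ι] {E : ι → ι → Prop} (hEs : ∀ ⦃i j : ι⦄, E i j → E j i)
    (hEm : MonotoneTransitive E) (v : ι) ⦃i j : ι⦄ (hi : i ∈ clique E v) (hj : j ∈ clique E v)
    (hij : i ≠ j) : E i j := by
  rw [mem_clique_iff] at hi hj
  rcases hi with rfl | ⟨hvi, hEi⟩ <;> rcases hj with rfl | ⟨hvj, hEj⟩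
  · exact absurd rfl hij
  · exact hEj
  · exact hEs hEi
  · exact hEm hvi hvj hij hEi hEj

end Graph

/-! ### Sparsity patterns and block supports of matrices -/

section Pattern

variable {R : Type*}

/-- `X` has SPARSITY PATTERN `E` (`X ∈ 𝕜ⁿ_E`): every off-diagonal entry outside `E` vanishes,
`X i j = 0` whenever `i ≠ j` and `{i,j} ∉ E` (diagonal entries and entries inside `E` are free,
in particular they may be zero). [cite: VandenbergheAndersen2015, §8.1] -/
def HasPattern [Zero R] (E : ι → ι → Prop) (X : Matrix ι ι R) : Prop :=
  ∀ ⦃i j : ι⦄, i ≠ j → ¬ E i j → X i j = 0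

/-- `X` is SUPPORTED ON the block `C × C`: `X i j = 0` unless `i ∈ C` and `j ∈ C` — i.e.
`X = P_Cᵀ H P_C` for the principal submatrix `H = X[C, C]` (the shape of the terms of (9.4) and of
the elements of the cones `𝒦_β` of (9.6): "one principal submatrix, in the rows and columns
indexed by `β`, and zero outside this block").
[cite: VandenbergheAndersen2015, §9.2 eq. (9.4) and (9.6)] -/
def SupportedOn [Zero R] (C : Set ι) (X : Matrix ι ι R) : Prop :=
  ∀ ⦃i j : ι⦄, i ∉ C ∨ j ∉ C → X i j = 0

/-- Enlarging the block keeps a matrix supported. [folklore] -/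
private theorem SupportedOn.mono [Zero R] {C D : Set ι} {X : Matrix ι ι R} (h : SupportedOn C X)
    (hCD : C ⊆ D) : SupportedOn D X :=
  fun _ _ hij => h (hij.imp (fun hi hiC => hi (hCD hiC)) fun hj hjC => hj (hCD hjC))

/-- The zero matrix is supported on every block (`0 ∈ 𝒦_β`, a convex cone).
[cite: VandenbergheAndersen2015, §9.2 eq. (9.6) (the cones `𝒦_β` are convex cones)] -/
theorem supportedOn_zero [Zero R] (C : Set ι) : SupportedOn C (0 : Matrix ι ι R) :=
  fun _ _ _ => rfl

/-- Sums of matrices supported on a block are supported on it (`𝒦_β + 𝒦_β ⊆ 𝒦_β`).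
[cite: VandenbergheAndersen2015, §9.2 eq. (9.6) (the cones `𝒦_β` are convex cones)] -/
theorem SupportedOn.add [AddZeroClass R] {C : Set ι} {X Y : Matrix ι ι R} (hX : SupportedOn C X)
    (hY : SupportedOn C Y) : SupportedOn C (X + Y) :=
  fun _ _ hij => by rw [Matrix.add_apply, hX hij, hY hij, add_zero]

/-- Finite sums of matrices supported on a block are supported on it.
[cite: VandenbergheAndersen2015, §9.2 eq. (9.6) (the cones `𝒦_β` are convex cones)] -/
theorem SupportedOn.sum [AddCommMonoid R] {C : Set ι} {κ : Type*} (s : Finset κ)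
    {X : κ → Matrix ι ι R} (h : ∀ k ∈ s, SupportedOn C (X k)) :
    SupportedOn C (∑ k ∈ s, X k) :=
  fun _ _ hij => by rw [Matrix.sum_apply]; exact Finset.sum_eq_zero fun k hk => h k hk hij

/-- The easy direction of [VA15, Thm 9.2]: a sum of matrices each supported on a block
`β k × β k` that is COMPLETE for `E` has sparsity pattern `E`.
[cite: VandenbergheAndersen2015, §9.2 Thm 9.2 (proof, first sentence)] -/
theorem hasPattern_sum_of_supportedOn [AddCommMonoid R] {E : ι → ι → Prop} {κ : Type*}
    (s : Finset κ) (β : κ → Set ι) (hβ : ∀ k ∈ s, ∀ ⦃i j : ι⦄, i ∈ β k → j ∈ β k → i ≠ j → E i j)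
    {H : κ → Matrix ι ι R} (hH : ∀ k ∈ s, SupportedOn (β k) (H k)) :
    HasPattern E (∑ k ∈ s, H k) := by
  intro i j hij hE
  rw [Matrix.sum_apply]
  refine Finset.sum_eq_zero fun k hk => hH k hk ?_
  by_contra h
  obtain ⟨hi, hj⟩ := not_or.mp h
  exact hE (hβ k hk (not_not.mp hi) (not_not.mp hj) hij)

end Pattern

/-! ### One step of symbolic elimination: the pivot (clique) term and its Schur complement -/

section Elimination

/-- The PIVOT TERM of vertex `a`: the rank-one matrix `(X a a)⁻¹ • X_{:,a} X_{a,:}` — the term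
`D_aa L_{:,a} L_{:,a}ᵀ` of the outer-product Cholesky factorisation [VA15, (9.5)] (for a zero
pivot Mathlib's `0⁻¹ = 0` makes it `0`). [cite: VandenbergheAndersen2015, §9.2 eq. (9.5)] -/
def pivotTerm (X : Matrix ι ι 𝕜) (a : ι) : Matrix ι ι 𝕜 :=
  (X a a)⁻¹ • vecMulVec (X.col a) (X.row a)

/-- Entries of the pivot term: `(X a a)⁻¹ X i a X a j`.
[cite: VandenbergheAndersen2015, §9.2 eq. (9.5)] -/
theorem pivotTerm_apply (X : Matrix ι ι 𝕜) (a i j : ι) :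
    pivotTerm X a i j = (X a a)⁻¹ * (X i a * X a j) :=
  rfl

/-- Row `a` of the Schur complement `X - pivotTerm X a` vanishes (nonzero pivot).
[cite: VandenbergheAndersen2015, §9.2 eq. (9.5)] -/
theorem sub_pivotTerm_apply_row (X : Matrix ι ι 𝕜) {a : ι} (ha : X a a ≠ 0) (j : ι) :
    (X - pivotTerm X a) a j = 0 := by
  rw [Matrix.sub_apply, pivotTerm_apply, ← mul_assoc, inv_mul_cancel₀ ha, one_mul, sub_self]

/-- Column `a` of the Schur complement `X - pivotTerm X a` vanishes (nonzero pivot).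
[cite: VandenbergheAndersen2015, §9.2 eq. (9.5)] -/
theorem sub_pivotTerm_apply_col (X : Matrix ι ι 𝕜) {a : ι} (ha : X a a ≠ 0) (i : ι) :
    (X - pivotTerm X a) i a = 0 := by
  rw [Matrix.sub_apply, pivotTerm_apply, mul_comm (X i a) (X a a), ← mul_assoc,
    inv_mul_cancel₀ ha, one_mul, sub_self]

variable [Fintype ι]

/-- The quadratic form of a rank-one matrix: `u ⋅ (v wᵀ) x = (u ⋅ v) (w ⋅ x)`. [folklore] -/
private theorem dotProduct_vecMulVec_mulVec (u v w x : ι → 𝕜) :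
    u ⬝ᵥ (vecMulVec v w *ᵥ x) = (u ⬝ᵥ v) * (w ⬝ᵥ x) := by
  simp only [dotProduct, Matrix.mulVec, Matrix.vecMulVec_apply]
  rw [Finset.sum_mul_sum]
  refine Finset.sum_congr rfl fun i _ => ?_
  rw [Finset.mul_sum]
  exact Finset.sum_congr rfl fun j _ => by ring

/-- The pivot term of a Hermitian matrix is Hermitian (the outer products `D_aa L_{:,a} L_{:,a}ᵀ`
of (9.5) are symmetric). [cite: VandenbergheAndersen2015, §9.2 eq. (9.5)] -/
theorem isHermitian_pivotTerm {X : Matrix ι ι 𝕜} (hX : X.IsHermitian) (a : ι) :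
    (pivotTerm X a).IsHermitian := by
  have hrow : X.row a = star (X.col a) := funext fun j => (hX.apply a j).symm
  have hd : IsSelfAdjoint (X a a)⁻¹ := by
    rw [isSelfAdjoint_iff, star_inv₀, hX.apply a a]
  rw [pivotTerm, hrow]
  exact IsSelfAdjoint.smul hd (Matrix.posSemidef_vecMulVec_self_star (X.col a)).1

variable [DecidableEq ι]

/-- A zero diagonal entry of a positive semidefinite matrix forces its whole column and row to
vanish (from `e_a⋆ X e_a = 0 ⟹ X e_a = 0`). [cite: HornJohnson2013, §7.1 Observation 7.1.10] -/
theorem apply_eq_zero_of_diag_eq_zero {X : Matrix ι ι 𝕜} (hX : X.PosSemidef) {a : ι}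
    (ha : X a a = 0) (i : ι) : X i a = 0 ∧ X a i = 0 := by
  have hcol : X *ᵥ Pi.single a 1 = 0 := by
    rw [← hX.dotProduct_mulVec_zero_iff, Matrix.mulVec_single_one, Pi.star_single, star_one,
      single_one_dotProduct]
    exact ha
  have hi : X i a = 0 := by
    have h := congr_fun hcol i
    rwa [Matrix.mulVec_single_one] at h
  exact ⟨hi, by rw [← hX.1.apply a i, hi, star_zero]⟩

/-- THE TWO QUADRATIC-FORM IDENTITIES OF ONE ELIMINATION STEP.  For Hermitian `X` with pivot
`d = X a a ≠ 0`, `K = pivotTerm X a`, `s = X_{a,:} x` and `t = d⁻¹ s`: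
`x⋆ K x = (t e_a)⋆ X (t e_a)` and `x⋆ (X - K) x = (x - t e_a)⋆ X (x - t e_a)`. [folklore] -/
private theorem quadForm_pivotTerm {X : Matrix ι ι 𝕜} (hX : X.IsHermitian) {a : ι} (ha : X a a ≠ 0)
    (x : ι → 𝕜) :
    star x ⬝ᵥ (pivotTerm X a *ᵥ x) =
      star (((X a a)⁻¹ * (star (X.col a) ⬝ᵥ x)) • Pi.single a (1 : 𝕜)) ⬝ᵥ
        (X *ᵥ (((X a a)⁻¹ * (star (X.col a) ⬝ᵥ x)) • Pi.single a (1 : 𝕜))) ∧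
    star x ⬝ᵥ ((X - pivotTerm X a) *ᵥ x) =
      star (x - ((X a a)⁻¹ * (star (X.col a) ⬝ᵥ x)) • Pi.single a (1 : 𝕜)) ⬝ᵥ
        (X *ᵥ (x - ((X a a)⁻¹ * (star (X.col a) ⬝ᵥ x)) • Pi.single a (1 : 𝕜))) := by
  have hrow : X.row a = star (X.col a) := funext fun j => (hX.apply a j).symm
  set c : ι → 𝕜 := X.col a with hc
  set d : 𝕜 := X a a with hd
  have hdstar : star d = d := hX.apply a a
  have hca : c a = d := rfl
  obtain ⟨s, hs⟩ : ∃ s : 𝕜, star c ⬝ᵥ x = s := ⟨_, rfl⟩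
  obtain ⟨q, hq⟩ : ∃ q : 𝕜, star x ⬝ᵥ (X *ᵥ x) = q := ⟨_, rfl⟩
  have hXe : X *ᵥ Pi.single a 1 = c := Matrix.mulVec_single_one X a
  have hsa : Pi.single a (1 : 𝕜) ⬝ᵥ (X *ᵥ x) = s := by
    rw [single_one_dotProduct, ← hs]
    change X.row a ⬝ᵥ x = _
    rw [hrow]
  have hxc : star x ⬝ᵥ c = star s := by rw [Matrix.star_dotProduct, hs]
  have hKdef : pivotTerm X a = d⁻¹ • vecMulVec c (star c) := by
    rw [pivotTerm, hrow]
  have hK : star x ⬝ᵥ (pivotTerm X a *ᵥ x) = d⁻¹ * (star s * s) := by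
    rw [hKdef, Matrix.smul_mulVec, dotProduct_smul, dotProduct_vecMulVec_mulVec, hxc, hs,
      smul_eq_mul]
  have hee : Pi.single a (1 : 𝕜) ⬝ᵥ (X *ᵥ Pi.single a 1) = d := by
    rw [hXe, single_one_dotProduct, hca]
  have hdd : d⁻¹ * d = 1 := inv_mul_cancel₀ ha
  rw [hs]
  constructor
  · rw [hK, star_smul, Pi.star_single, star_one, Matrix.mulVec_smul, smul_dotProduct,
      dotProduct_smul, hee, star_mul', star_inv₀, hdstar]
    simp only [smul_eq_mul]
    linear_combination (-(d⁻¹ * star s * s)) * hdd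
  · rw [Matrix.sub_mulVec, dotProduct_sub, hK, hq, star_sub, star_smul, Pi.star_single, star_one,
      Matrix.mulVec_sub, Matrix.mulVec_smul, hXe, sub_dotProduct, dotProduct_sub, dotProduct_sub,
      hq, dotProduct_smul, hxc, smul_dotProduct, smul_dotProduct, hsa, dotProduct_smul,
      single_one_dotProduct, hca, star_mul', star_inv₀, hdstar]
    simp only [smul_eq_mul]
    linear_combination (-(d⁻¹ * star s * s)) * hdd

/-- The pivot term `(X a a)⁻¹ X_{:,a} X_{a,:}` of a positive semidefinite matrix at a nonzero
pivot is positive semidefinite (`x⋆ K x = d⁻¹ |X_{a,:} x|² = (t e_a)⋆ X (t e_a) ≥ 0`).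
[cite: VandenbergheAndersen2015, §9.2 proof of Thm 9.2 (each term of (9.5) is PSD)] -/
theorem posSemidef_pivotTerm {X : Matrix ι ι 𝕜} (hX : X.PosSemidef) {a : ι} (ha : X a a ≠ 0) :
    (pivotTerm X a).PosSemidef :=
  .of_dotProduct_mulVec_nonneg (isHermitian_pivotTerm hX.1 a) fun x => by
    rw [(quadForm_pivotTerm hX.1 ha x).1]
    exact hX.dotProduct_mulVec_nonneg _

/-- ONE ELIMINATION STEP PRESERVES POSITIVE SEMIDEFINITENESS: for `X ⪰ 0` with pivot
`X a a ≠ 0` the Schur complement `X - (X a a)⁻¹ X_{:,a} X_{a,:}` is positive semidefinite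
(`x⋆ (X - K) x = z⋆ X z ≥ 0`, `z = x - d⁻¹ (X_{a,:} x) e_a`) — the matrix `A_k` of outer-product
Cholesky stays PSD. [cite: HornJohnson2013, §7.7 eq. (7.7.5)] -/
theorem posSemidef_sub_pivotTerm {X : Matrix ι ι 𝕜} (hX : X.PosSemidef) {a : ι}
    (ha : X a a ≠ 0) : (X - pivotTerm X a).PosSemidef :=
  .of_dotProduct_mulVec_nonneg (hX.1.sub (isHermitian_pivotTerm hX.1 a)) fun x => by
    rw [(quadForm_pivotTerm hX.1 ha x).2]
    exact hX.dotProduct_mulVec_nonneg _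

end Elimination

/-! ### The decomposition theorem -/

section Decomposition

variable [Fintype ι] [LinearOrder ι]

/-- The induction behind [VA15, Thm 9.2]: eliminate the vertices of the support `S` of `X` in the
elimination (= linear) order; each step splits off a PSD clique term supported on
`col(a) × col(a)` and leaves a PSD Schur complement with the same pattern supported on `S \ {a}`
(zero fill-in by monotone transitivity).
[cite: VandenbergheAndersen2015, §9.2 Thm 9.2 (proof via (9.5))] -/
theorem exists_clique_decomposition_of_support {E : ι → ι → Prop}
    (hEs : ∀ ⦃i j : ι⦄, E i j → E j i) (hEm : MonotoneTransitive E) (S : Finset ι) :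
    ∀ X : Matrix ι ι 𝕜, X.PosSemidef → HasPattern E X → (∀ i j, i ∉ S ∨ j ∉ S → X i j = 0) →
      ∃ H : ι → Matrix ι ι 𝕜, (∀ v, (H v).PosSemidef) ∧ (∀ v, SupportedOn (clique E v) (H v)) ∧
        X = ∑ v, H v := by
  induction S using Finset.induction_on_min with
  | empty =>
    intro X hX hXE hXS
    refine ⟨fun _ => 0, fun _ => PosSemidef.zero, fun _ => supportedOn_zero _, ?_⟩
    rw [Finset.sum_const_zero]
    ext i j
    exact hXS i j (Or.inl (by simp))
  | insert a s hlt ih =>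
    intro X hX hXE hXS
    by_cases ha : X a a = 0
    · -- zero pivot: row and column `a` vanish, so `X` is already supported on `s`
      refine ih X hX hXE fun i j hij => ?_
      rcases hij with hi | hj
      · by_cases hia : i = a
        · rw [hia]; exact (apply_eq_zero_of_diag_eq_zero hX ha j).2
        · exact hXS i j (Or.inl (by simp [hia, hi]))
      · by_cases hja : j = a
        · rw [hja]; exact (apply_eq_zero_of_diag_eq_zero hX ha i).1
        · exact hXS i j (Or.inr (by simp [hja, hj]))
    · -- nonzero pivot: split off the clique term of `a`
      have hcol : ∀ i, X i a ≠ 0 → i ∈ clique E a := fun i hi => by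
        by_cases hia : i = a
        · exact mem_clique_iff.mpr (Or.inl hia)
        · have his : i ∈ insert a s := by
            by_contra h
            exact hi (hXS i a (Or.inl h))
          have hE : E i a := by
            by_contra h
            exact hi (hXE hia h)
          exact mem_clique_iff.mpr
            (Or.inr ⟨hlt i ((Finset.mem_insert.mp his).resolve_left hia), hEs hE⟩)
      have hrow : ∀ j, X a j ≠ 0 → j ∈ clique E a := fun j hj => by
        by_cases hja : j = a
        · exact mem_clique_iff.mpr (Or.inl hja)
        · have hjs : j ∈ insert a s := by
            by_contra h
            exact hj (hXS a j (Or.inr h))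
          have hE : E a j := by
            by_contra h
            exact hj (hXE (Ne.symm hja) h)
          exact mem_clique_iff.mpr
            (Or.inr ⟨hlt j ((Finset.mem_insert.mp hjs).resolve_left hja), hE⟩)
      -- the clique term is PSD and supported on `col(a) × col(a)`
      have hKpsd : (pivotTerm X a).PosSemidef := posSemidef_pivotTerm hX ha
      have hKS : SupportedOn (clique E a) (pivotTerm X a) := by
        intro i j hij
        rw [pivotTerm_apply]
        rcases hij with hi | hj
        · have h0 : X i a = 0 := by
            by_contra h
            exact hi (hcol i h)
          rw [h0, zero_mul, mul_zero]
        · have h0 : X a j = 0 := by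
            by_contra h
            exact hj (hrow j h)
          rw [h0, mul_zero, mul_zero]
      -- the Schur complement is PSD, keeps the pattern (zero fill-in), and lives on `s`
      have hY : (X - pivotTerm X a).PosSemidef := posSemidef_sub_pivotTerm hX ha
      have hYE : HasPattern E (X - pivotTerm X a) := by
        intro i j hij hEij
        rw [Matrix.sub_apply, pivotTerm_apply, hXE hij hEij, zero_sub, neg_eq_zero]
        by_contra hne
        have hia : X i a ≠ 0 := fun h0 => hne (by rw [h0, zero_mul, mul_zero])
        have haj : X a j ≠ 0 := fun h0 => hne (by rw [h0, mul_zero, mul_zero])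
        exact hEij (clique_complete hEs hEm a (hcol i hia) (hrow j haj) hij)
      have hYS : ∀ i j, i ∉ s ∨ j ∉ s → (X - pivotTerm X a) i j = 0 := by
        intro i j hij
        rcases hij with hi | hj
        · by_cases hia : i = a
          · rw [hia]; exact sub_pivotTerm_apply_row X ha j
          · have hi' : i ∉ insert a s := by simp [hia, hi]
            rw [Matrix.sub_apply, pivotTerm_apply, hXS i j (Or.inl hi'), hXS i a (Or.inl hi'),
              zero_mul, mul_zero, sub_zero]
        · by_cases hja : j = a
          · rw [hja]; exact sub_pivotTerm_apply_col X ha i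
          · have hj' : j ∉ insert a s := by simp [hja, hj]
            rw [Matrix.sub_apply, pivotTerm_apply, hXS i j (Or.inr hj'), hXS a j (Or.inr hj'),
              mul_zero, mul_zero, sub_zero]
      -- induct and add the clique term to `H a`
      obtain ⟨H, hH1, hH2, hH3⟩ := ih (X - pivotTerm X a) hY hYE hYS
      refine ⟨fun v => H v + if v = a then pivotTerm X a else 0, fun v => ?_, fun v => ?_, ?_⟩
      · show (H v + if v = a then pivotTerm X a else 0).PosSemidef
        split_ifs with hv
        · exact (hH1 v).add hKpsd
        · rw [add_zero]; exact hH1 v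
      · show SupportedOn (clique E v) (H v + if v = a then pivotTerm X a else 0)
        split_ifs with hv
        · subst hv; exact (hH2 _).add hKS
        · rw [add_zero]; exact hH2 v
      · show X = ∑ v, (H v + if v = a then pivotTerm X a else 0)
        rw [Finset.sum_add_distrib, Finset.sum_ite_eq', if_pos (Finset.mem_univ a), ← hH3,
          sub_add_cancel]

/-- **Clique decomposition of positive semidefinite matrices with a chordal sparsity pattern**
([VA15, Thm 9.2]; Griewank–Toint 1984 Thm 4, Agler–Helton–McCullough–Rodman 1988 Thm 2.3,
Kakimura 2010 Thm 1), per-vertex form of the proof via (9.5): if the symmetric pattern `E` is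
monotone transitive for the order of `ι` (a perfect elimination ordering — `E` chordal), every
positive semidefinite `X` with pattern `E` is a sum `X = Σ_v H_v` of positive semidefinite matrices
`H_v` supported on the complete blocks `col(v) × col(v)`.
[cite: VandenbergheAndersen2015, §9.2 Thm 9.2] -/
theorem exists_clique_decomposition {E : ι → ι → Prop} (hEs : ∀ ⦃i j : ι⦄, E i j → E j i)
    (hEm : MonotoneTransitive E) {X : Matrix ι ι 𝕜} (hX : X.PosSemidef) (hXE : HasPattern E X) :
    ∃ H : ι → Matrix ι ι 𝕜, (∀ v, (H v).PosSemidef) ∧ (∀ v, SupportedOn (clique E v) (H v)) ∧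
      X = ∑ v, H v :=
  exists_clique_decomposition_of_support hEs hEm Finset.univ X hX hXE fun i j hij => by
    simp at hij

/-- [VA15, Thm 9.2] as an equivalence (`𝐒ⁿ₊ ∩ 𝐒ⁿ_E = Σ_v 𝒦_{col(v)}`, [VA15, (9.6)]): for a
monotone-transitive (chordal, perfect-elimination-ordered) symmetric pattern `E`, a matrix is
positive semidefinite with pattern `E` iff it is a sum of positive semidefinite matrices supported
on the blocks `col(v) × col(v)`. [cite: VandenbergheAndersen2015, §9.2 Thm 9.2 and eq. (9.6)] -/
theorem posSemidef_and_hasPattern_iff {E : ι → ι → Prop} (hEs : ∀ ⦃i j : ι⦄, E i j → E j i)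
    (hEm : MonotoneTransitive E) (X : Matrix ι ι 𝕜) :
    (X.PosSemidef ∧ HasPattern E X) ↔
      ∃ H : ι → Matrix ι ι 𝕜, (∀ v, (H v).PosSemidef) ∧ (∀ v, SupportedOn (clique E v) (H v)) ∧
        X = ∑ v, H v := by
  constructor
  · rintro ⟨hX, hXE⟩
    exact exists_clique_decomposition hEs hEm hX hXE
  · rintro ⟨H, hH1, hH2, rfl⟩
    exact ⟨posSemidef_sum _ fun v _ => hH1 v,
      hasPattern_sum_of_supportedOn _ (fun v => clique E v) (fun v _ => clique_complete hEs hEm v)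
        fun v _ => hH2 v⟩

/-- [VA15, Thm 9.2] in the clique-indexed form (9.4): for ANY family of index sets `β k`
(`k : κ`) and assignment `f` of vertices with `col(v) ⊆ β (f v)` — e.g. `β` the maximal cliques
and `f v` a maximal clique containing the complete set `col(v)` — a positive semidefinite `X` with
the chordal pattern `E` is `Σ_k H_k` with `H_k ⪰ 0` supported on `β k × β k`.
[cite: VandenbergheAndersen2015, §9.2 Thm 9.2 eq. (9.4)] -/
theorem exists_decomposition_of_cover {κ : Type*} [Fintype κ] [DecidableEq κ]
    {E : ι → ι → Prop} (hEs : ∀ ⦃i j : ι⦄, E i j → E j i) (hEm : MonotoneTransitive E)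
    (β : κ → Set ι) (f : ι → κ) (hf : ∀ v, clique E v ⊆ β (f v)) {X : Matrix ι ι 𝕜}
    (hX : X.PosSemidef) (hXE : HasPattern E X) :
    ∃ H : κ → Matrix ι ι 𝕜, (∀ k, (H k).PosSemidef) ∧ (∀ k, SupportedOn (β k) (H k)) ∧
      X = ∑ k, H k := by
  obtain ⟨G, hG1, hG2, hG3⟩ := exists_clique_decomposition hEs hEm hX hXE
  refine ⟨fun k => ∑ v ∈ Finset.univ.filter (fun v => f v = k), G v, fun k => ?_, fun k => ?_,
    ?_⟩
  · exact posSemidef_sum _ fun v _ => hG1 v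
  · refine SupportedOn.sum _ fun v hv => (hG2 v).mono ?_
    rw [Finset.mem_filter] at hv
    exact hv.2 ▸ hf v
  · rw [hG3]
    exact (Finset.sum_fiberwise Finset.univ f G).symm

/-- The decomposition theorem for a `SimpleGraph` whose vertex order is a perfect elimination
ordering (`MonotoneTransitive G.Adj`). [cite: VandenbergheAndersen2015, §9.2 Thm 9.2] -/
theorem simpleGraph_exists_clique_decomposition (G : SimpleGraph ι)
    (hG : MonotoneTransitive G.Adj) {X : Matrix ι ι 𝕜} (hX : X.PosSemidef)
    (hXE : HasPattern G.Adj X) :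
    ∃ H : ι → Matrix ι ι 𝕜, (∀ v, (H v).PosSemidef) ∧
      (∀ v, SupportedOn (clique G.Adj v) (H v)) ∧ X = ∑ v, H v :=
  exists_clique_decomposition (fun _ _ h => G.adj_symm h) hG hX hXE

end Decomposition

end ChordalSparsity

end Literature.LinearAlgebra.Matrix

end
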